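import Summits.Ventures.PercRepro.Night2FaceSum

/-!
# PercRepro — the PER-BASIS loss bound: the excess of a covering basis from its face sum (night-2, gen 20)

The loss mass bounds of gens 18–19 charge every lossy pair `(B, z)` the uniform `λ = R − cap/ρ`, i.e. a covering
basis `Q = B ∪ {z}` the total `ρ λ`, as if all its `ρ` faces were as fat as possible.  By `Night2FaceSum` the faces
`cl (Q ∖ w)` of a covering basis miss `m_w ≥ 2` points each with `Σ_w m_w ≥ 2 n − ρ` (`n = |G ∖ K|`) and
`m_w ≤ n − ρ + 1`, so the TOTAL loss at `Q`, `Σ_w loss (Q ∖ w) w = L1 Q − cap Q ≤ Φ Σ_w 1/(m_w + d) − capDG`, is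
bounded through any linear majorant `1/(m + d) ≤ a − b m` (`b ≥ 0`, valid on `2 ≤ m ≤ n − ρ + 1` — the chord of
the convex function over that range) by `excessBound = Φ (ρ a − b (2 n − ρ)) − capDG`:

* `faceLoss`, `sum_faceLoss_le_L1_mul`: the losses of the `ρ` faces of `Q` sum to `L1 Q · (1 − fS Q)`;
* `L1_le_sum_faces`: `L1 Q ≤ Φ Σ_{w ∈ Q ∖ K} 1/(m_w + d)`;
* **`sum_faceLoss_le_excessBound`**: the total loss at a covering basis is at most `excessBound`;
* **`pi2Mass_le_excess`**: the loss mass of a target is at most `C(|S ∖ K|, ρ) · excessBound/(2^{n−ρ} − 1)`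
  (the loss pairs are grouped by their covering basis);
* **`localShadowHall_excess_of_sum`**: (LI_G) in the partial-spread regime (`m₁` on the non-basis members) as
  soon as `genSum n ρ t c′ (excessBound/ρ) ≥ 1`.

At `q = 5` (`Night2ExcessCells`) this turns `ρ λ = 2/5` at `(3, 0)` into `0.26` at `n = 12`, and shrinks every
residue of `Night2SevenFiveResidues`.
-/

namespace PercRepro.Shadow

open Finset PerFlat ThmH

/-- The per-basis excess bound `Φ (ρ a − b (2 n − ρ)) − capDG`. -/
noncomputable def excessBound (q d ρ k n : ℕ) (a b : ℚ) : ℚ :=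
  phiQ q * ((ρ : ℚ) * a - b * (2 * (n : ℚ) - (ρ : ℚ))) - capDG q d k

variable {α : Type*} [DecidableEq α] {M : Matroid α} [M.Finite]

/-- The loss of the face `Q ∖ w` of `Q` at `w` (zero unless `Q ∖ w` is a thin member with `w ∉ cl (Q ∖ w)`). -/
noncomputable def faceLoss (M : Matroid α) [M.Finite] (q : ℕ) (G Q : Finset α) (w : α) : ℚ :=
  if Q.erase w ∈ thinMembers M q G ∧ w ∈ G \ clF M (Q.erase w) then loss M q G (Q.erase w) w else 0

/-- Face losses are nonnegative. -/
theorem faceLoss_nonneg {q : ℕ} {G : Finset α} (hG : G ∈ flatsQ M (q + 1)) (hd : (gr M \ G).card ≤ q)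
    (Q : Finset α) (w : α) : 0 ≤ faceLoss M q G Q w := by
  unfold faceLoss
  split_ifs
  · exact loss_nonneg' hG hd _ _
  · exact le_refl _

/-- `|G ∖ Q| + ρ = |G ∖ K|` for a shadow set `Q` with `|Q ∖ K| = ρ`. -/
theorem card_sdiff_add_eq_of_mem_shadowAt {q ρ : ℕ} {G : Finset α} {Q : Finset α}
    (hQ : Q ∈ shadowAt M (q + 2) q (Uq M (q + 2) q) G) (hQc : (Q \ coloops M G).card = ρ) :
    (G \ Q).card + ρ = (G \ coloops M G).card := by
  have hQG : Q ⊆ G := subset_G_of_mem_shadowAt hQ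
  have hKQ : coloops M G ⊆ Q := coloops_subset_of_mem_shadowAt hQ
  have hdisj : Disjoint (G \ Q) (Q \ coloops M G) := by
    rw [Finset.disjoint_left]
    intro x hx hx'
    exact (Finset.mem_sdiff.1 hx).2 (Finset.mem_sdiff.1 hx').1
  have h1 : (G \ coloops M G) = (G \ Q) ∪ (Q \ coloops M G) := by
    ext x
    simp only [Finset.mem_union, Finset.mem_sdiff]
    constructor
    · rintro ⟨hxG, hxK⟩
      by_cases hxQ : x ∈ Q
      · exact Or.inr ⟨hxQ, hxK⟩
      · exact Or.inl ⟨hxG, hxQ⟩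
    · rintro (⟨hxG, hxQ⟩ | ⟨hxQ, hxK⟩)
      · exact ⟨hxG, fun h => hxQ (hKQ h)⟩
      · exact ⟨hQG hxQ, hxK⟩
  rw [h1, Finset.card_union_of_disjoint hdisj, hQc]

/-- The request of a subset of `G` is at most `Φ/(|G ∖ cl B| + d)`. -/
theorem req_le_of_subset_G {q d : ℕ} {G : Finset α} (hG : G ∈ flatsQ M (q + 1)) (hd : (gr M \ G).card = d)
    (hd1 : 1 ≤ d) {B : Finset α} (hB : B ⊆ G) :
    req M q B ≤ phiQ q / (((G \ clF M B).card : ℚ) + (d : ℚ)) := by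
  have hGg : G ⊆ gr M := (mem_flatsQ.1 hG).1
  have hcl : clF M B ⊆ G := clF_subset_of_subset_flatsQ hG hB
  have hsub : (G \ clF M B) ∪ (gr M \ G) ⊆ gr M \ clF M B := by
    intro x hx
    rw [Finset.mem_union, Finset.mem_sdiff, Finset.mem_sdiff] at hx
    rw [Finset.mem_sdiff]
    rcases hx with ⟨hxG, hxc⟩ | ⟨hxg, hxG⟩
    · exact ⟨hGg hxG, hxc⟩
    · exact ⟨hxg, fun h => hxG (hcl h)⟩
  have hdisj : Disjoint (G \ clF M B) (gr M \ G) := by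
    rw [Finset.disjoint_left]
    intro x hx hx'
    exact (Finset.mem_sdiff.1 hx').2 (Finset.mem_sdiff.1 hx).1
  have hcard : (G \ clF M B).card + d ≤ (gr M \ clF M B).card := by
    rw [← hd, ← Finset.card_union_of_disjoint hdisj]
    exact Finset.card_le_card hsub
  unfold req
  apply div_le_div_of_nonneg_left (phiQ_pos q).le (by positivity)
  exact_mod_cast hcard

open scoped Classical in
/-- **`L1 Q ≤ Φ Σ_{w ∈ Q ∖ K} 1/(m_w + d)`**: the thin covering preimages of `Q` are among the faces `Q ∖ w`. -/
theorem L1_le_sum_faces {q d : ℕ} {G : Finset α} (hG : G ∈ flatsQ M (q + 1)) (hd : (gr M \ G).card = d)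
    (hd1 : 1 ≤ d) (hdq : d ≤ q) {Q : Finset α} (hQ : Q ∈ shadowAt M (q + 2) q (Uq M (q + 2) q) G) :
    L1 M q G Q ≤ phiQ q * ∑ w ∈ Q \ coloops M G, 1 / (((G \ clF M (Q.erase w)).card : ℚ) + (d : ℚ)) := by
  have hd' : (gr M \ G).card ≤ q := by omega
  have hQG : Q ⊆ G := subset_G_of_mem_shadowAt hQ
  have hsub1 := thin_coverPreimages_subset_image_coloops hG hd' Q
  have hsub2 : Finset.image (fun w => Q.erase w) (coloops M (Q \ coloops M G)) ⊆
      Finset.image (fun w => Q.erase w) (Q \ coloops M G) :=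
    Finset.image_subset_image (fun w hw => (mem_coloops.1 hw).1)
  unfold L1
  calc ∑ B ∈ (coverPreimages M (Uq M (q + 2) q) G Q).filter (fun B => B ∉ lay0 M q G), req M q B
      ≤ ∑ B ∈ Finset.image (fun w => Q.erase w) (Q \ coloops M G), req M q B :=
        Finset.sum_le_sum_of_subset_of_nonneg (hsub1.trans hsub2) (fun B _ _ => req_nonneg q B)
    _ = ∑ w ∈ Q \ coloops M G, req M q (Q.erase w) := by
        apply Finset.sum_image
        intro w hw w' hw' heq
        exact Finset.erase_injOn Q (Finset.mem_sdiff.1 hw).1 (Finset.mem_sdiff.1 hw').1 heq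
    _ ≤ ∑ w ∈ Q \ coloops M G, phiQ q / (((G \ clF M (Q.erase w)).card : ℚ) + (d : ℚ)) := by
        apply Finset.sum_le_sum
        intro w _
        exact req_le_of_subset_G hG hd hd1 ((Finset.erase_subset w Q).trans hQG)
    _ = phiQ q * ∑ w ∈ Q \ coloops M G, 1 / (((G \ clF M (Q.erase w)).card : ℚ) + (d : ℚ)) := by
        rw [Finset.mul_sum]
        apply Finset.sum_congr rfl
        intro w _
        rw [mul_one_div]

open scoped Classical in
/-- **The face losses of `Q` sum to at most `L1 Q · (1 − fS Q)`.** -/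
theorem sum_faceLoss_le_L1_mul {q : ℕ} {G : Finset α} (hG : G ∈ flatsQ M (q + 1)) (hd : (gr M \ G).card ≤ q)
    (Q : Finset α) :
    ∑ w ∈ Q \ coloops M G, faceLoss M q G Q w ≤ L1 M q G Q * (1 - fS M q G Q) := by
  have hcap : 0 ≤ capS M q G Q := capS_nonneg' hG hd Q
  have hf : 0 ≤ 1 - fS M q G Q := sub_nonneg.2 (fS_le_one hcap)
  set W := (Q \ coloops M G).filter
    (fun w => Q.erase w ∈ thinMembers M q G ∧ w ∈ G \ clF M (Q.erase w)) with hW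
  have h1 : ∑ w ∈ Q \ coloops M G, faceLoss M q G Q w =
      (∑ w ∈ W, req M q (Q.erase w)) * (1 - fS M q G Q) := by
    unfold faceLoss
    rw [Finset.sum_ite, Finset.sum_const_zero, add_zero, Finset.sum_mul]
    apply Finset.sum_congr rfl
    intro w hw
    have hwQ : w ∈ Q := (Finset.mem_sdiff.1 (Finset.mem_filter.1 hw).1).1
    unfold loss
    rw [Finset.insert_erase hwQ]
  rw [h1]
  apply mul_le_mul_of_nonneg_right _ hf
  -- the faces in W are thin covering preimages of Q
  have himg : Finset.image (fun w => Q.erase w) W ⊆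
      (coverPreimages M (Uq M (q + 2) q) G Q).filter (fun B => B ∉ lay0 M q G) := by
    intro B hB
    rw [Finset.mem_image] at hB
    obtain ⟨w, hw, rfl⟩ := hB
    have hw' := (Finset.mem_filter.1 hw).2
    have hwQ : w ∈ Q := (Finset.mem_sdiff.1 (Finset.mem_filter.1 hw).1).1
    rw [Finset.mem_filter, mem_coverPreimages]
    refine ⟨⟨(mem_thinMembers.1 hw'.1).1, ?_⟩, (mem_thinMembers.1 hw'.1).2⟩
    rw [mem_coverSets]
    exact ⟨w, hw'.2, Finset.insert_erase hwQ⟩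
  unfold L1
  calc ∑ w ∈ W, req M q (Q.erase w) = ∑ B ∈ Finset.image (fun w => Q.erase w) W, req M q B := by
        rw [Finset.sum_image]
        intro w hw w' hw' heq
        exact Finset.erase_injOn Q (Finset.mem_sdiff.1 (Finset.mem_filter.1 hw).1).1
          (Finset.mem_sdiff.1 (Finset.mem_filter.1 hw').1).1 heq
    _ ≤ ∑ B ∈ (coverPreimages M (Uq M (q + 2) q) G Q).filter (fun B => B ∉ lay0 M q G), req M q B :=
        Finset.sum_le_sum_of_subset_of_nonneg himg (fun B _ _ => req_nonneg q B)

/-- `L1 · (1 − fS) ≤ max 0 (L1 − capS)`. -/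
theorem L1_mul_one_sub_fS_le {q : ℕ} {G Q : Finset α} (hcap : 0 ≤ capS M q G Q) :
    L1 M q G Q * (1 - fS M q G Q) ≤ max 0 (L1 M q G Q - capS M q G Q) := by
  unfold fS
  split_ifs with h
  · simp only [sub_self, mul_zero]; exact le_max_left _ _
  · push Not at h
    have hL : 0 < L1 M q G Q := hcap.trans_lt h
    rw [mul_sub, mul_one, mul_div_cancel₀ _ hL.ne']
    exact le_max_right _ _

open scoped Classical in
/-- **THE PER-BASIS LOSS BOUND**: under a linear majorant `1/(m + d) ≤ a − b m` (`b ≥ 0`) on `2 ≤ m ≤ n − ρ + 1`,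
the face losses of a covering basis `Q` (`|Q ∖ K| = ρ`) sum to at most `excessBound q d ρ k n a b`. -/
theorem sum_faceLoss_le_excessBound {q d ρ : ℕ} {G : Finset α} (hG : G ∈ flatsQ M (q + 1))
    (hd : (gr M \ G).card = d) (hdq : d ≤ q) (hk : kColoops M G + ρ = q + 1) (hkd : kColoops M G + 1 ≤ d)
    (hs : ∀ e ∈ gr M, ∀ f ∈ gr M, e ≠ f → rkN M {e, f} = 2) (hl : ∀ e ∈ gr M, M.Indep {e})
    {a b : ℚ} (hb : 0 ≤ b)
    (hchord : ∀ m : ℕ, 2 ≤ m → m ≤ (G \ coloops M G).card - ρ + 1 →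
      1 / ((m : ℚ) + (d : ℚ)) ≤ a - b * (m : ℚ))
    (hE : 0 ≤ excessBound q d ρ (kColoops M G) (G \ coloops M G).card a b)
    {Q : Finset α} (hQ : Q ∈ shadowAt M (q + 2) q (Uq M (q + 2) q) G) (hQc : (Q \ coloops M G).card = ρ) :
    ∑ w ∈ Q \ coloops M G, faceLoss M q G Q w ≤ excessBound q d ρ (kColoops M G) (G \ coloops M G).card a b := by
  have hd' : (gr M \ G).card ≤ q := by omega
  have hd1 : 1 ≤ d := by omega
  have hQG : Q ⊆ G := subset_G_of_mem_shadowAt hQ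
  have hcap : 0 ≤ capS M q G Q := capS_nonneg' hG hd' Q
  have hcapDG : capDG q d (kColoops M G) ≤ capS M q G Q := by
    unfold capDG; exact capS_ge_one_sub_kColoops (q := q) hd hQG
  set n := (G \ coloops M G).card with hn
  -- the chord on every face
  have hface : ∀ w ∈ Q \ coloops M G,
      1 / (((G \ clF M (Q.erase w)).card : ℚ) + (d : ℚ)) ≤ a - b * ((G \ clF M (Q.erase w)).card : ℚ) := by
    intro w hw
    apply hchord
    · exact two_le_card_face hk hQ hQc hw
    · have h1 := card_face_le hG hQ (w := w)
      have h2 := card_sdiff_add_eq_of_mem_shadowAt hQ hQc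
      omega
  have hsumfaces := two_mul_card_le_sum_faces hG hk hs hl hQ hQc
  have hL1 : L1 M q G Q ≤ phiQ q * ((ρ : ℚ) * a - b * (2 * (n : ℚ) - (ρ : ℚ))) := by
    calc L1 M q G Q ≤ phiQ q * ∑ w ∈ Q \ coloops M G, 1 / (((G \ clF M (Q.erase w)).card : ℚ) + (d : ℚ)) :=
          L1_le_sum_faces hG hd hd1 hdq hQ
      _ ≤ phiQ q * ∑ w ∈ Q \ coloops M G, (a - b * ((G \ clF M (Q.erase w)).card : ℚ)) :=
          mul_le_mul_of_nonneg_left (Finset.sum_le_sum hface) (phiQ_pos q).le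
      _ = phiQ q * ((ρ : ℚ) * a - b * ∑ w ∈ Q \ coloops M G, ((G \ clF M (Q.erase w)).card : ℚ)) := by
          rw [Finset.sum_sub_distrib, Finset.sum_const, hQc, nsmul_eq_mul, Finset.mul_sum]
      _ ≤ phiQ q * ((ρ : ℚ) * a - b * (2 * (n : ℚ) - (ρ : ℚ))) := by
          apply mul_le_mul_of_nonneg_left _ (phiQ_pos q).le
          have hcast : (2 * (n : ℚ) - (ρ : ℚ)) ≤ ∑ w ∈ Q \ coloops M G, ((G \ clF M (Q.erase w)).card : ℚ) := by
            have h := hsumfaces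
            rw [← hn] at h
            have h' : ((2 * n : ℕ) : ℚ) ≤ ((ρ + ∑ w ∈ Q \ coloops M G, (G \ clF M (Q.erase w)).card : ℕ) : ℚ) := by
              exact_mod_cast h
            push_cast at h'
            linarith
          nlinarith [hcast, hb]
  calc ∑ w ∈ Q \ coloops M G, faceLoss M q G Q w ≤ L1 M q G Q * (1 - fS M q G Q) :=
        sum_faceLoss_le_L1_mul hG hd' Q
    _ ≤ max 0 (L1 M q G Q - capS M q G Q) := L1_mul_one_sub_fS_le hcap
    _ ≤ excessBound q d ρ (kColoops M G) n a b := by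
        apply max_le hE
        unfold excessBound
        linarith

end PercRepro.Shadow
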